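import Literature.MathematicalPhysics.QuantumFieldTheory.Balaban1983to89.B9Eq386GreenLipschitzEnergy
import Mathlib.Analysis.Complex.Liouville
import Mathlib.Analysis.Analytic.Constructions
import Mathlib.Analysis.Calculus.DiffContOnCl
import Mathlib.Analysis.Calculus.MeanValue
import Mathlib.Topology.Algebra.Module.FiniteDimension

/-!
# `Balaban1983to89.B9Eq386GreenAnalyticPencilEnergy` — T. Bałaban, *Propagators for lattice gauge theories in a background field*, Commun. Math. Phys.
# **99** (1985) 389–434 [Balaban1985BackgroundPropagators] Thm 3.4 p. 400, (3.84)–(3.86) p. 407, Thm 3.11 p. 416, with T. Kato, *Perturbation theory for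
# linear operators* (1966) [Kato1966] Ch. VI §3, Ch. VII §4: **KATO TYPE-(B) IN A COVARIANT ENERGY WEIGHT — the inverse of the LINEAR OPERATOR PENCIL
# `S₀ + z•D` with `S₀` `γ`-coercive in a weight `N ≥ ‖·‖` and `D` of FORM size `Θ` in `N` is ANALYTIC on `‖z‖ ≤ R₁ < γ∕Θ`, bounded by `(γ − R₁Θ)⁻¹`,
# with CAUCHY majorants `‖∂_zⁿ(S₀ + zD)⁻¹|₀‖ ≤ n!(γ − R₁Θ)⁻¹R₁⁻ⁿ` and the first-order difference `‖(S₀ + D)⁻¹ − S₀⁻¹‖ ≤ (γ − R₁Θ)⁻¹∕(R₁ − 1)`** —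
# abstract finite-dimensional Hilbert letters; the all-orders companion of this lineage's first-order `B9Eq326ConjugatedDeltaAEnergyWeight` (N52 road (α))

statement-level skeleton of published theorems with citation tags; proofs where landed; nothing here is a claim about the Yang–Mills mass gap

CITATION HEADER (lean-in-tree rule).  Audit cell `pub-balaban`, sub-cell `t4`, BINDER row NE9; filed by NE9 formalisation-swarm LEAF PROVER 01
(`b2b-balaban-t4-ne9-formalise-leaf-01`, gen 88) under the crux-ideation seat t4-ne9-idea-1 gen 152's located note N53 («Kato type-(B) in the covariant
energy weight»; cell journal 2026-08-25 l.63736; card `t4/ideate/NE9/lens1-g152/N53-TYPEB-PENCIL-g152.md`), leaf-01 named first.  CREDIT: the mechanism AND the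
Lean text of §§1–5 are t4-ne9-idea-1 g152's scratch kernel `NE9TypeBPencil` (a47aa271e3aba532, NOT-TO-FILE under the cell's FREEZE (0)), ported here token for
token (namespace, header and docstring locators only are this seat's).  Imports the NE9 owner's `B9Eq386GreenLipschitzEnergy` (`weight_green_le`; through it
`B11Eq103H1Complex.greenK`, `bijective_of_rePosDef`) and Mathlib's complex analysis (`analyticAt_inverse`, `Complex.norm_iteratedDeriv_le_of_forall_mem_sphere_norm_le`,
`Complex.norm_deriv_le_of_forall_mem_sphere_norm_le`, `Convex.norm_image_sub_le_of_norm_deriv_le`).  Sources READ first-hand in the held text layer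
(`paper:balaban1985-cmp99-background-propagators`, journal page = PDF page + 388): p. 400 Thm 3.4 *«The operators G′(U), (Q′(U)G′²(U)Q′*(U))⁻¹, R(U), G(U) extend to
configurations U′U for α ≤ α₁ as analytic functions of A … we prove quantitative statements which are more precise, describing these analytic extensions as
small perturbations of the operators depending on U only»*, p. 407 (3.86) *«G(U′U) = G(U)(I − V(A)G(U))⁻¹ … convergence is in the operator norm for α₁
sufficiently small»*, p. 416 Thm 3.11.  Print's analyticity is the operator-norm Neumann series (3.86) (in the tree: `B9Eq386NeumannAnalytic.analyticAt_gNew_comp`,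
`B9Eq361VprimeAnalytic` — radius `‖C′(A)L⁻¹‖ < 1`, `η`-dependent at the `Δ_a` level); the FORM-currency pencil here is the ROUTE's substitute (`t4/ROUTES-NE9.md`
§L1.4, N52 road (α) ∕ N53); nothing of print's radius is asserted.

WHY THIS FILE (cell context, N53 §§1–4).  Road (α) of N52 (`B9Eq326ConjugatedDeltaAEnergyWeight` §4, `…TwoBackgrounds`, `…TowerTwoBackgrounds`) is the FIRST
order: `‖G_κ(V) − G_κ(U)‖ ≤ (Θ∕γ′)C₀` from a form defect `Θ` in a weight where `H_κ(U)` is `γ′`-coercive.  Freeze `S₀ := H_κ(U)`, `D := H_κ(V) − H_κ(U)`: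
the LINEAR pencil `S₀ + zD` is `(γ′ − R₁Θ)`-coercive on `‖z‖ ≤ R₁` (§1 — type-(B) openness, quantitative: coercivity in a weight persists under a form
defect, no operator bound of `D`), hence a unit of `E →L[ℂ] E` whose `Ring.inverse` IS the tree's `greenK` (§2), hence `z ↦ (S₀ + zD)⁻¹` is analytic
(§3, Mathlib's `analyticAt_inverse` around ANY unit — no Neumann smallness in operator norm) and bounded by `(γ′ − R₁Θ)⁻¹` on the disc, so Cauchy gives
every order (§4).  Every constant is a function of `(γ, Θ, R₁)`: a Combes–Thomas `κ` frozen inside `S₀, D` rides along UNIFORMLY on `‖κ‖ = r`, and each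
order inherits the read-out `B9Eq349BondBlockDecayFromCircle.norm_bondBlock_le_exp_of_uniform_circle_bound`.

WHAT IS PROVED (sorry-free; proof lane — no `def`; [folklore] finite-dimensional Hilbert-space algebra + Mathlib complex analysis).
* §1 **`coerciveN_of_formDefect`** (`γN² ≤ re⟨u,T₀u⟩`, `|⟨u,Tv⟩ − ⟨u,T₀v⟩| ≤ ΘN(u)N(v)` ⟹ `(γ − Θ)N² ≤ re⟨u,Tu⟩`), `formDefect_pencil`.
* §2 `rePos_of_coerciveN`, **`isUnit_of_rePos`**, **`inverse_eq_greenK`** (`Ring.inverse S = toContinuousLinearMap (greenK ↑S hpos)`), `inverse_apply_eq_greenK`,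
  `weight_inverse_apply_le` (`N(S⁻¹y) ≤ γ⁻¹‖y‖`), `norm_inverse_le` (`‖S⁻¹‖ ≤ γ⁻¹`).
* §3 **`analyticAt_inverse_comp`** (`f` analytic at `z₀`, `f z₀` a unit ⟹ `z ↦ (f z)⁻¹` analytic at `z₀`).
* §4 the pencil (`S₀` `γ`-coercive in `N ≥ ‖·‖`, `D` of form size `Θ`, `0 < R₁`, `R₁Θ < γ`): `coerciveN_pencil`, **`norm_inverse_pencil_le`**
  (`‖(S₀ + z•D)⁻¹‖ ≤ (γ − R₁Θ)⁻¹` on `‖z‖ ≤ R₁`), `analyticAt_inverse_pencil`, **`norm_iteratedDeriv_inverse_pencil_le`**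
  (`‖iteratedDeriv n (z ↦ (S₀ + z•D)⁻¹) 0‖ ≤ n!·(γ − R₁Θ)⁻¹∕R₁ⁿ`), **`norm_inverse_add_sub_inverse_le`** (`1 < R₁` ⟹ `‖(S₀ + D)⁻¹ − S₀⁻¹‖ ≤ (γ − R₁Θ)⁻¹∕(R₁ − 1)`),
  `weight_inverse_pencil_apply_le` (`N((S₀ + z•D)⁻¹y) ≤ (γ − R₁Θ)⁻¹‖y‖`).
* §5 non-vacuity (the identity pencil on `ℂ`).
MODEL ∕ HONEST SCOPE.  (M1) abstract letters; `E` finite-dimensional (complete) over `ℂ` in §§3–4.  (M2) DISPLAYED: `γ`, `Θ`, `R₁`; at the lattice `γ = γ′ =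
min(¼, γ_{3.11}∕8)` of `…EnergyWeight.coerciveN_k` and `Θ` = `…TwoBackgrounds`' defect (both monotone in `‖κ‖ ≤ R`) — that junction is NOT here.  (M3) the
first order of §4 at `R₁ = γ∕(2Θ)` is `4Θ∕(γ(γ − 2Θ))`, the same order `Θ∕γ²` as road (α)'s `(Θ∕γ′)γ′⁻¹` with a WORSE constant — this file is the
all-orders statement, not a better first order; the GROUP pencil `z ↦ H_κ(V·e^{zA})` (what a consumer of `T4CouplingAnalyticity`-shape ultimately reads) is
NOT here.  (M4) not print's Thm 3.4 ∕ (3.86) (operator currency) and no replacement for it where print needs operator currency; no kernel ∕ sup bound; no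
rate, no window evaluated.  NOT NE9 (cell pub-balaban: NE9 NOT PRINTED ∕ NOT PROVED; «NE9 ⇐ the named binders»; row WALLED ON A MODEL (O-NE9-1; #5 UNRULED);
spine PROVED 0∕9; rung (B)+1 on a finite T⁴ — NOT infinite volume, NOT mass gap, NOT BetaPertH, NOT Clay).  HONEST DEPENDENCY (cell line): continuum YM on
T⁴ ⇐ BetaPertH ∧ nine spine estimates (0/9 proved); BetaPertH ⇐ (D1) ∧ (D4) ∧ CAP+tail; G-an2-4 gates asym, D1 and NE2/3/4.  NEW file; nothing modified.  Net
new unproved facts: 0.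
-/

noncomputable section

open scoped InnerProductSpace ComplexConjugate
open Metric Set

namespace Literature.MathematicalPhysics.QuantumFieldTheory.Balaban1983to89.B9Eq386GreenAnalyticPencilEnergy

open B11Eq103H1Complex (greenK apply_greenK greenK_apply bijective_of_rePosDef)
open B9Eq386GreenLipschitzEnergy (weight_green_le)

/-! ## §1 Persistence of coercivity under a form defect (type (B) openness, quantitative) -/

section Defect

variable {𝕜 : Type*} [RCLike 𝕜] {E : Type*} [NormedAddCommGroup E] [InnerProductSpace 𝕜 E]

/-- **COERCIVITY IN A WEIGHT PERSISTS UNDER A FORM DEFECT**: `γN(u)² ≤ re⟨u, T₀u⟩` and `|⟨u, Tv⟩ − ⟨u, T₀v⟩| ≤ Θ·N(u)·N(v)` give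
`(γ − Θ)N(u)² ≤ re⟨u, Tu⟩` — no linearity, no operator bound of `T − T₀`. [folklore] [cite: Kato1966, Ch. VI §3, Ch. VII §4] -/
theorem coerciveN_of_formDefect (N : E → ℝ) {γ Θ : ℝ} {T₀ T : E → E}
    (hco : ∀ u, γ * N u ^ 2 ≤ RCLike.re ⟪u, T₀ u⟫_𝕜)
    (hdef : ∀ u v, ‖⟪u, T v⟫_𝕜 - ⟪u, T₀ v⟫_𝕜‖ ≤ Θ * N u * N v) (u : E) :
    (γ - Θ) * N u ^ 2 ≤ RCLike.re ⟪u, T u⟫_𝕜 := by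
  have h1 := hco u
  have h2 := hdef u u
  have h3 : -‖⟪u, T u⟫_𝕜 - ⟪u, T₀ u⟫_𝕜‖ ≤ RCLike.re (⟪u, T u⟫_𝕜 - ⟪u, T₀ u⟫_𝕜) :=
    (abs_le.mp (RCLike.abs_re_le_norm _)).1
  have h4 : RCLike.re (⟪u, T u⟫_𝕜 - ⟪u, T₀ u⟫_𝕜) = RCLike.re ⟪u, T u⟫_𝕜 - RCLike.re ⟪u, T₀ u⟫_𝕜 := map_sub _ _ _
  have h5 : Θ * N u * N u = Θ * N u ^ 2 := by ring
  nlinarith [h1, h2, h3, h4, h5]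

/-- **A SCALED DEFECT**: `|⟨u, Dv⟩| ≤ ΘN(u)N(v)` and `‖z‖ ≤ R₁` give the defect `R₁Θ` for `T₀ + z•D` against `T₀`. [folklore] [cite: Kato1966, Ch. VII §4; Balaban1985BackgroundPropagators, (3.52)–(3.53) p.400] -/
theorem formDefect_pencil (N : E → ℝ) (hN : ∀ w, 0 ≤ N w) {Θ R₁ : ℝ} (hΘ : 0 ≤ Θ) (S₀ D : E →L[𝕜] E)
    (hD : ∀ u v, ‖⟪u, D v⟫_𝕜‖ ≤ Θ * N u * N v) {z : 𝕜} (hz : ‖z‖ ≤ R₁) (u v : E) :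
    ‖⟪u, (S₀ + z • D) v⟫_𝕜 - ⟪u, S₀ v⟫_𝕜‖ ≤ R₁ * Θ * N u * N v := by
  have h0 : (S₀ + z • D) v = S₀ v + z • D v := rfl
  have h1 : ⟪u, (S₀ + z • D) v⟫_𝕜 - ⟪u, S₀ v⟫_𝕜 = z * ⟪u, D v⟫_𝕜 := by
    rw [h0, inner_add_right, inner_smul_right]; ring
  rw [h1, norm_mul]
  have h2 : 0 ≤ Θ * N u * N v := by have := hN u; have := hN v; positivity
  calc ‖z‖ * ‖⟪u, D v⟫_𝕜‖ ≤ R₁ * (Θ * N u * N v) :=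
        mul_le_mul hz (hD u v) (norm_nonneg _) ((norm_nonneg z).trans hz)
    _ = R₁ * Θ * N u * N v := by ring

end Defect

/-! ## §2 Coercivity ⟹ positivity ⟹ unit of `E →L[𝕜] E`, `Ring.inverse = greenK`, `‖T⁻¹‖ ≤ γ⁻¹` -/

section Unit

variable {𝕜 : Type*} [RCLike 𝕜] {E : Type*} [NormedAddCommGroup E] [InnerProductSpace 𝕜 E]

/-- **`hpos` DERIVED**: strong coercivity in a weight dominating the norm gives `0 < re⟨x, Tx⟩` for `x ≠ 0`. [folklore] [cite: Balaban1985BackgroundPropagators, Thm 3.11 p.416] -/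
theorem rePos_of_coerciveN (N : E → ℝ) (hNn : ∀ u, ‖u‖ ≤ N u) {γ : ℝ} (hγ : 0 < γ) {T : E → E}
    (hco : ∀ u, γ * N u ^ 2 ≤ RCLike.re ⟪u, T u⟫_𝕜) (x : E) (hx : x ≠ 0) : 0 < RCLike.re ⟪x, T x⟫_𝕜 := by
  have h1 : 0 < ‖x‖ := norm_pos_iff.mpr hx
  have h2 : 0 < N x := lt_of_lt_of_le h1 (hNn x)
  have h3 : 0 < γ * N x ^ 2 := by positivity
  exact lt_of_lt_of_le h3 (hco x)

variable [FiniteDimensional 𝕜 E]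

/-- **A POSITIVE OPERATOR IS A UNIT OF THE NORMED ALGEBRA `E →L[𝕜] E`** (finite dimension: injective ⟹ bijective ⟹ a continuous linear
equivalence ⟹ `ContinuousLinearEquiv.toUnit`). [folklore] [cite: Balaban1985BackgroundPropagators, Thm 3.11 p.416; Balaban1985Variational, (110) p.294] -/
theorem isUnit_of_rePos (S : E →L[𝕜] E) (hpos : ∀ x : E, x ≠ 0 → 0 < RCLike.re ⟪x, (S : E →ₗ[𝕜] E) x⟫_𝕜) : IsUnit S := by
  let e : E ≃ₗ[𝕜] E := LinearEquiv.ofBijective (S : E →ₗ[𝕜] E) (bijective_of_rePosDef hpos)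
  refine ⟨e.toContinuousLinearEquiv.toUnit, ?_⟩
  ext x
  rfl

/-- **`Ring.inverse S = greenK S`** — the algebra inverse of a positive operator IS the tree's Green's function (as a continuous linear map). [folklore] [cite: Balaban1985Variational, (110) p.294; Balaban1985BackgroundPropagators, Thm 3.11 p.416] -/
theorem inverse_eq_greenK (S : E →L[𝕜] E) (hpos : ∀ x : E, x ≠ 0 → 0 < RCLike.re ⟪x, (S : E →ₗ[𝕜] E) x⟫_𝕜) :
    Ring.inverse S = LinearMap.toContinuousLinearMap (greenK (S : E →ₗ[𝕜] E) hpos) := by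
  have hu := isUnit_of_rePos S hpos
  have h1 : Ring.inverse S * S = 1 := Ring.inverse_mul_cancel S hu
  ext y
  have h2 : Ring.inverse S (S (greenK (S : E →ₗ[𝕜] E) hpos y)) = greenK (S : E →ₗ[𝕜] E) hpos y :=
    congrArg (fun R : E →L[𝕜] E => R (greenK (S : E →ₗ[𝕜] E) hpos y)) h1
  have h3 : S (greenK (S : E →ₗ[𝕜] E) hpos y) = y := apply_greenK hpos y
  rw [h3] at h2
  rw [h2, LinearMap.coe_toContinuousLinearMap']

/-- **`Ring.inverse S y = greenK S y`** pointwise. [folklore] [cite: Balaban1985Variational, (110) p.294] -/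
theorem inverse_apply_eq_greenK (S : E →L[𝕜] E) (hpos : ∀ x : E, x ≠ 0 → 0 < RCLike.re ⟪x, (S : E →ₗ[𝕜] E) x⟫_𝕜) (y : E) :
    Ring.inverse S y = greenK (S : E →ₗ[𝕜] E) hpos y := by
  rw [inverse_eq_greenK S hpos, LinearMap.coe_toContinuousLinearMap']

/-- **THE ROW AND THE OPERATOR BOUND OF THE INVERSE FROM COERCIVITY IN A WEIGHT**: `γN² ≤ re⟨u, Su⟩`, `‖·‖ ≤ N` ⟹
`N(S⁻¹y) ≤ γ⁻¹‖y‖` (the tree's `weight_green_le` BY NAME) and `‖S⁻¹‖ ≤ γ⁻¹`. [folklore] [cite: Balaban1985BackgroundPropagators, Thm 3.4 p.400] -/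
theorem weight_inverse_apply_le (N : E → ℝ) (hN : ∀ w, 0 ≤ N w) (hNn : ∀ u, ‖u‖ ≤ N u) {γ : ℝ} (hγ : 0 < γ) (S : E →L[𝕜] E)
    (hco : ∀ u, γ * N u ^ 2 ≤ RCLike.re ⟪u, S u⟫_𝕜) (y : E) : N (Ring.inverse S y) ≤ γ⁻¹ * ‖y‖ := by
  have hpos : ∀ x : E, x ≠ 0 → 0 < RCLike.re ⟪x, (S : E →ₗ[𝕜] E) x⟫_𝕜 := rePos_of_coerciveN N hNn hγ hco
  rw [inverse_apply_eq_greenK S hpos]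
  exact weight_green_le hpos N hN hNn hγ hco y

/-- **`‖S⁻¹‖ ≤ γ⁻¹`** for `S` `γ`-coercive in a weight `N ≥ ‖·‖`. [folklore] [cite: Balaban1985BackgroundPropagators, Thm 3.4 p.400, Thm 3.11 p.416] -/
theorem norm_inverse_le (N : E → ℝ) (hN : ∀ w, 0 ≤ N w) (hNn : ∀ u, ‖u‖ ≤ N u) {γ : ℝ} (hγ : 0 < γ) (S : E →L[𝕜] E)
    (hco : ∀ u, γ * N u ^ 2 ≤ RCLike.re ⟪u, S u⟫_𝕜) : ‖Ring.inverse S‖ ≤ γ⁻¹ := by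
  refine ContinuousLinearMap.opNorm_le_bound _ (inv_nonneg.mpr hγ.le) fun y => ?_
  exact (hNn _).trans (weight_inverse_apply_le N hN hNn hγ S hco y)

end Unit

/-! ## §3 The inverse of an analytic coercive family is analytic (no Neumann smallness in operator norm) -/

section Analytic

variable {E : Type*} [NormedAddCommGroup E] [InnerProductSpace ℂ E] [CompleteSpace E]

/-- **`z ↦ (f z)⁻¹` IS ANALYTIC AT `z₀` WHEN `f` IS AND `f z₀` IS A UNIT** — Mathlib's `analyticAt_inverse` (around ANY unit, not around `1`)
composed; with §2 the unit comes from coercivity in a weight, not from an operator-norm smallness. [folklore]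
[cite: Balaban1985BackgroundPropagators, Thm 3.4 p.400, (3.86) p.407; Kato1966, Ch. VII §4] -/
theorem analyticAt_inverse_comp {f : ℂ → (E →L[ℂ] E)} {z₀ : ℂ} (hf : AnalyticAt ℂ f z₀) (hu : IsUnit (f z₀)) :
    AnalyticAt ℂ (fun z => Ring.inverse (f z)) z₀ := by
  have h2 : AnalyticAt ℂ Ring.inverse (↑hu.unit : E →L[ℂ] E) := analyticAt_inverse (𝕜 := ℂ) hu.unit
  exact h2.comp_of_eq hf hu.unit_spec.symm

end Analytic

/-! ## §4 THE PENCIL END: uniform inverse bound on a disc, Cauchy estimates at every order, the first-order difference -/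

section Pencil

variable {E : Type*} [NormedAddCommGroup E] [InnerProductSpace ℂ E] [CompleteSpace E] [FiniteDimensional ℂ E]
  (N : E → ℝ) (hN : ∀ w, 0 ≤ N w) (hNn : ∀ u, ‖u‖ ≤ N u) {γ Θ R₁ : ℝ} (hΘ : 0 ≤ Θ) (hR₁ : 0 < R₁) (hgap : R₁ * Θ < γ)
  (S₀ D : E →L[ℂ] E) (hco : ∀ u, γ * N u ^ 2 ≤ RCLike.re ⟪u, S₀ u⟫_ℂ) (hD : ∀ u v, ‖⟪u, D v⟫_ℂ‖ ≤ Θ * N u * N v)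

omit [CompleteSpace E] [FiniteDimensional ℂ E] in
include hN hΘ hco hD in
/-- On the closed disc `‖z‖ ≤ R₁` the pencil `S₀ + z•D` is `(γ − R₁Θ)`-coercive in `N`. [folklore] [cite: Kato1966, Ch. VII §4; Balaban1985BackgroundPropagators, Thm 3.4 p.400] -/
theorem coerciveN_pencil {z : ℂ} (hz : ‖z‖ ≤ R₁) (u : E) : (γ - R₁ * Θ) * N u ^ 2 ≤ RCLike.re ⟪u, (S₀ + z • D) u⟫_ℂ :=
  coerciveN_of_formDefect N (T₀ := fun v => S₀ v) (T := fun v => (S₀ + z • D) v) hco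
    (formDefect_pencil N hN hΘ S₀ D hD hz) u

omit [CompleteSpace E] in
include hN hNn hΘ hgap hco hD in
/-- **UNIFORM INVERSE BOUND ON THE DISC**: `‖(S₀ + z•D)⁻¹‖ ≤ (γ − R₁Θ)⁻¹` for `‖z‖ ≤ R₁`. [folklore] [cite: Kato1966, Ch. VII §4; Balaban1985BackgroundPropagators, Thm 3.4 p.400] -/
theorem norm_inverse_pencil_le {z : ℂ} (hz : ‖z‖ ≤ R₁) : ‖Ring.inverse (S₀ + z • D)‖ ≤ (γ - R₁ * Θ)⁻¹ :=
  norm_inverse_le N hN hNn (sub_pos.mpr hgap) (S₀ + z • D) (coerciveN_pencil N hN hΘ S₀ D hco hD hz)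

include hN hNn hΘ hgap hco hD in
/-- The pencil's inverse is a unit on the disc and `z ↦ (S₀ + z•D)⁻¹` is analytic there. [folklore] [cite: Kato1966, Ch. VII §4; Balaban1985BackgroundPropagators, Thm 3.4 p.400, (3.86) p.407] -/
theorem analyticAt_inverse_pencil {z : ℂ} (hz : ‖z‖ ≤ R₁) : AnalyticAt ℂ (fun w : ℂ => Ring.inverse (S₀ + w • D)) z := by
  have hf : AnalyticAt ℂ (fun w : ℂ => S₀ + w • D) z := analyticAt_const.add (analyticAt_id.smul analyticAt_const)
  have hpos := rePos_of_coerciveN N hNn (sub_pos.mpr hgap) (coerciveN_pencil N hN hΘ S₀ D hco hD hz)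
  exact analyticAt_inverse_comp hf (isUnit_of_rePos (S₀ + z • D) hpos)

include hN hNn hΘ hgap hco hD hR₁ in
/-- **CAUCHY AT EVERY ORDER**: `‖iteratedDeriv n (z ↦ (S₀ + z•D)⁻¹) 0‖ ≤ n!·(γ − R₁Θ)⁻¹∕R₁ⁿ` — the Taylor coefficients of the inverse in the
perturbation direction are majorised GEOMETRICALLY with ratio `R₁⁻¹` for every `R₁ < γ∕Θ`, from FORM smallness `Θ < γ∕R₁` only. [folklore]
[cite: Kato1966, Ch. VII §4 (analytic families of type (B)); Balaban1985BackgroundPropagators, (3.86) p.407] -/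
theorem norm_iteratedDeriv_inverse_pencil_le (n : ℕ) :
    ‖iteratedDeriv n (fun w : ℂ => Ring.inverse (S₀ + w • D)) 0‖ ≤ n.factorial * (γ - R₁ * Θ)⁻¹ / R₁ ^ n := by
  have hdiff : DifferentiableOn ℂ (fun w : ℂ => Ring.inverse (S₀ + w • D)) (closedBall 0 R₁) := fun z hz =>
    (analyticAt_inverse_pencil N hN hNn hΘ hgap S₀ D hco hD (by simpa using hz)).differentiableAt.differentiableWithinAt
  have hdc : DiffContOnCl ℂ (fun w : ℂ => Ring.inverse (S₀ + w • D)) (ball 0 R₁) := hdiff.diffContOnCl_ball (le_refl _)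
  exact Complex.norm_iteratedDeriv_le_of_forall_mem_sphere_norm_le n hR₁ hdc fun z hz =>
    norm_inverse_pencil_le N hN hNn hΘ hgap S₀ D hco hD (by rw [mem_sphere_zero_iff_norm.mp hz])

include hN hNn hΘ hgap hco hD in
/-- **THE FIRST-ORDER DIFFERENCE BY THE MEAN VALUE THEOREM ON THE UNIT DISC**: for `R₁ > 1`,
`‖(S₀ + D)⁻¹ − S₀⁻¹‖ ≤ (γ − R₁Θ)⁻¹∕(R₁ − 1)` (Cauchy for the derivative on the discs of radius `R₁ − 1` centred in the unit disc). [folklore] [cite: Kato1966, Ch. VII §4; Balaban1985BackgroundPropagators, (3.86) p.407] -/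
theorem norm_inverse_add_sub_inverse_le (hR₁1 : 1 < R₁) :
    ‖Ring.inverse (S₀ + D) - Ring.inverse S₀‖ ≤ (γ - R₁ * Θ)⁻¹ / (R₁ - 1) := by
  set g : ℂ → (E →L[ℂ] E) := fun w => Ring.inverse (S₀ + w • D) with hg
  -- differentiability on the closed disc of radius `R₁`
  have hdiffAt : ∀ z : ℂ, ‖z‖ ≤ R₁ → DifferentiableAt ℂ g z := fun z hz =>
    (analyticAt_inverse_pencil N hN hNn hΘ hgap S₀ D hco hD hz).differentiableAt
  -- the derivative bound on the unit disc
  have hderiv : ∀ x ∈ closedBall (0 : ℂ) 1, ‖deriv g x‖ ≤ (γ - R₁ * Θ)⁻¹ / (R₁ - 1) := by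
    intro x hx
    have hx1 : ‖x‖ ≤ 1 := by simpa using hx
    have hsub : closedBall x (R₁ - 1) ⊆ closedBall (0 : ℂ) R₁ := by
      intro y hy
      have hy' : ‖y - x‖ ≤ R₁ - 1 := by simpa [dist_eq_norm] using hy
      have : ‖y‖ ≤ ‖y - x‖ + ‖x‖ := by
        calc ‖y‖ = ‖(y - x) + x‖ := by rw [sub_add_cancel]
          _ ≤ ‖y - x‖ + ‖x‖ := norm_add_le _ _
      simpa using (this.trans (by linarith))
    have hdiff : DifferentiableOn ℂ g (closedBall (0 : ℂ) R₁) := fun z hz =>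
      (hdiffAt z (by simpa using hz)).differentiableWithinAt
    have hdc : DiffContOnCl ℂ g (ball x (R₁ - 1)) := hdiff.diffContOnCl_ball hsub
    refine Complex.norm_deriv_le_of_forall_mem_sphere_norm_le (sub_pos.mpr hR₁1) hdc fun z hz => ?_
    have hz' : ‖z‖ ≤ R₁ := by simpa using hsub (sphere_subset_closedBall hz)
    exact norm_inverse_pencil_le N hN hNn hΘ hgap S₀ D hco hD hz'
  have hmv := (convex_closedBall (0 : ℂ) 1).norm_image_sub_le_of_norm_deriv_le
    (fun x hx => hdiffAt x ((show ‖x‖ ≤ 1 by simpa using hx).trans hR₁1.le)) hderiv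
    (by simp : (0 : ℂ) ∈ closedBall (0 : ℂ) 1) (by simp : (1 : ℂ) ∈ closedBall (0 : ℂ) 1)
  have h0 : g 0 = Ring.inverse S₀ := by simp [hg]
  have h1 : g 1 = Ring.inverse (S₀ + D) := by simp [hg]
  rw [← h0, ← h1]
  simpa using hmv

omit [CompleteSpace E] in
include hN hNn hΘ hgap hco hD in
/-- **THE ROWS RIDE ALONG**: on the disc, `N((S₀ + z•D)⁻¹y) ≤ (γ − R₁Θ)⁻¹‖y‖` — the energy-weight row of every member of the family, the input of
the decay read-out when a conjugation `κ` is frozen inside `S₀, D`. [folklore] [cite: Balaban1985BackgroundPropagators, Thm 3.4 p.400, (3.49) p.399] -/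
theorem weight_inverse_pencil_apply_le {z : ℂ} (hz : ‖z‖ ≤ R₁) (y : E) :
    N (Ring.inverse (S₀ + z • D) y) ≤ (γ - R₁ * Θ)⁻¹ * ‖y‖ :=
  weight_inverse_apply_le N hN hNn (sub_pos.mpr hgap) (S₀ + z • D) (coerciveN_pencil N hN hΘ S₀ D hco hD hz) y

end Pencil

/-! ## §5 Non-vacuity: the identity pencil on `ℂ` -/

section NonVacuity

/-- The hypotheses of §4 are inhabited: `E = ℂ`, `N = ‖·‖`, `S₀ = 1`, `D = 0`, `γ = 1`, `Θ = 0`, any `R₁ > 0`. [cite: Kato1966, Ch. VII §4] -/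
example : ∀ u : ℂ, (1 : ℝ) * ‖u‖ ^ 2 ≤ RCLike.re ⟪u, (1 : ℂ →L[ℂ] ℂ) u⟫_ℂ := fun u => by
  simp [inner_self_eq_norm_sq_to_K]
  norm_cast

/-- … and the zero perturbation has form size `Θ = 0`. [folklore] [cite: Kato1966, Ch. VII §4] -/
example : ∀ u v : ℂ, ‖⟪u, (0 : ℂ →L[ℂ] ℂ) v⟫_ℂ‖ ≤ (0 : ℝ) * ‖u‖ * ‖v‖ := fun u v => by simp

end NonVacuity

end Literature.MathematicalPhysics.QuantumFieldTheory.Balaban1983to89.B9Eq386GreenAnalyticPencilEnergy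

end
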